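import Mathlib.Order.SymmDiff
import Literature.Probability.LatticeModels.DartPhase
import Literature.Barriers.CriticalPhenomena.FKParafermionicHalfCauchyRiemann
import HarnessLib

/-!
# Zhou's modified `q = 1` edge parafermionic observables `F̃`, `F_i` on `ℤ²`

Definition item `defn-ZhouModifiedParafermion` (topic `Literature/Probability/LatticeModels`;
wanted by crux `SymmetryUpgradeR` of `CriticalPhenomena/CardyFormulaZ2`, line
`zhou-rotation-split-audit`). Source: W. Zhou, *SLE₆ and 2-d critical bond percolation on the
square lattice*, arXiv:2409.03235v6 (17 Dec 2024), 115 pp., UNREFEREED [Zhou2024SLE6BondZ2]: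
§3.1 (pp. 22–38, Prop. 3.2), §3.3 (pp. 46–51, Prop. 3.6), §4 (pp. 51–52, eqs. (77)–(82)).
Only DEFINITIONS are vendored; none of the paper's claims (Lemma 3.1, Props. 3.2, 3.6, 4.1, 4.3,
4.4, Thms. 1–2) is stated here, neither as a theorem nor as a named fact.

## The printed objects

Fix a medial vertex `v` with its four incident medial edges `A, B, C, D` "indexed in the
counterclockwise order such that `A` and `C` are pointing towards `v`" (p. 22), `E_v` the
lattice edge through `v`, `γ = γ_δ(ω)` the exploration path. "There are four possibilities when
`γ_δ` passes though `v` and only two medial edges incident to `v` are in `γ_δ`" (p. 22; pp. 34–35):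
`j = 1`: `A, D ∈ γ; B, C ∉ γ`; `j = 2`: `A, B ∈ γ; C, D ∉ γ`; `j = 3`: `B, C ∈ γ; A, D ∉ γ`;
`j = 4`: `C, D ∈ γ; A, B ∉ γ`. Zhou splits possibility `j` into two classes
`E^v_{j,1} ⊔ E^v_{j,2}` and builds, by local reflection–flip surgeries of `ω` around `v`
(eqs. (36)–(44); §3.3, Class I/II), an exceptional event `E_v = E_{v,0} ∪ E_{v,1}`,
`E_{v,1} = {ω∖E_v : ω ∈ E_{v,0}}` (p. 38, p. 50) and a map `f_v` such that (Prop. 3.2 p. 38 =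
Prop. 3.6 p. 50 verbatim up to the error exponent): "After ignoring `E_v` with probability at
most of the order `(δ/d)²`, there is a mapping `f_v : E^v_{j,2} ∖ E_v ↦ E^v_{j+1,1} ∖ E_v` for
`j = 1, 2, 3, 4` such that `f_v` is a one-to-one and onto mapping, where `E^v_{5,1}` is
understood as `E^v_{1,1}`. In addition, `W_{f_v(γ)}(A, e_b) = W_γ(A, e_b), ω ∈ E^v_{1,2} ∖ E_v`;
`W_{f_v(γ)}(B, e_b) = W_γ(B, e_b), ω ∈ E^v_{2,2} ∖ E_v`; `… (C …), E^v_{3,2}`; `… (D …), E^v_{4,2}`"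
(the medial edge common to possibilities `j` and `j + 1` keeps its winding). With
`E^{v,a}_{j,m} = {ω∖E_v : ω ∈ E^v_{j,m}}` — the configuration with the status of `E_v` switched,
after which "the four medial edges `A, B, C, D` incident to `v` are in `γ_δ(ω)`" (p. 49) — and
`φ_e = exp((i/3) W_γ(e, e_b)) 1(e ∈ γ)` he sets (eqs. (77)–(80), pp. 51–52)
* `F_θ(e) = e^{-iθ} E[φ_e; ω ∈ ⋃_j E^{v,a}_{j,2} ∖ E_v] + e^{iθ} E[φ_e; ω ∈ ⋃_j E^{v,a}_{j,1} ∖ E_v]`,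
* `F_one(e) = E[φ_e; ω ∈ ⋃_j (E^v_{j,1} ∪ E^v_{j,2}) ∖ E_v]`,
  `F_two(e) = E[φ_e; ω ∈ ⋃_j (E^{v,a}_{j,1} ∪ E^{v,a}_{j,2}) ∖ E_v]`, `F_ex(e) = E[φ_e; ω ∈ E_v]`
  ("`F(A) = F_one(A) + F_two(A) + F_ex(A)`", (80)),
and then (Definition, p. 52, eqs. (81)–(82); the constants were re-read from the glyph layer of
the v6 PDF, the text extraction being garbled: numerator `3√3 + 5` over denominator `6√3 + 6`,
`√3 − 1` over `√2`, and `1` over `2`):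
* `F̃(e_v) = (3√3 + 5)/(6√3 + 6) · (√3 F_one(e_v) + F_two(e_v) + ((√3 − 1)/√2) F_{π/12}(e_v)) + ½ F_ex(e_v)`,
* `F_i(e_v) = F(e_v) − F̃(e_v)`, where `e_v = A, B, C, D`.

## What is formalised (namespace `Literature.Probability.LatticeModels.Zhou`)

Over the tree's square-lattice vocabulary — `DiscreteDobrushin`, `medialExploration`, corners
`(v, f) : Site 2 × Site 2` = oriented medial edges (`cornerSource → cornerTarget`), medial
vertices indexed by `p = (x, i) : Site 2 × Fin 2` (`medialVertexOf p = s(x, x + eᵢ)`) with their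
four corners `medialCornersAt x i k`, `k = 0,1,2,3` clockwise `NW, NE, SE, SW`
(`FKParafermionicHalfCauchyRiemann.lean`), and the dart phase sum `dartPhaseSum` / raw edge
observable `bondDartObservable` of `DartPhase.lean`:
* `labelIndex`, `edge p l` — Zhou's labels `l = 0,1,2,3 = A,B,C,D` at `p`, CERTIFIED: `A`, `C`
  point towards the vertex and `B`, `D` away from it (`cornerTarget_edge_zero/two`,
  `cornerSource_edge_one/three`), counterclockwise (`labelIndex_succ`);
* `Traverses γ c`, `dartWinding γ δ c` — the dart `c` is used by the path `γ` / the winding of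
  `γ` from its start up to that dart (the real companion of `dartPhaseSum`);
* `passTwo E p J` (possibility `j = J + 1`: of the four darts at `p` exactly `J` and `J − 1` are
  traversed), `passTwoAny`, `passFour`, and `flipAt p ω = ω ∆ {E_v}` (Zhou's `ω∖E_v`);
* `RotationPairing` — the DATA `(E_v, ⋃_j E^v_{j,2}, f_v)` of Prop. 3.2/3.6 — with the classes
  `cls₂ π J = E^v_{J,2}`, `cls₁ π J = E^v_{J,1}`, and `IsRotationPairing E p π` — its PRINTED
  PROPERTIES except the probability bound on `E_v` (which is the paper's claim and belongs to
  route items): `E_v = E₀ ∪ flipAt(E₀)` with `E₀ ⊆ ⋃_J passTwo`, `f_v` a bijection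
  `E^v_{J,2} ∖ E_v → E^v_{J+1,1} ∖ E_v` for every `J : Fin 4`, preserving the winding of dart `J`;
* `obsOn E S c = E[φ_c; S]`, `Ftheta` (77), `Fone` (78), `Ftwo` (79), `Fex`, `modifiedObs = F̃`
  (81) with `coefMain = (3√3+5)/(6√3+6)` (`= (2+√3)/6`, `coefMain_eq`) and
  `coefTheta = (√3−1)/√2`, `Fi` (82) — as functions of (datum `E`, medial vertex `p`,
  pairing `π`, dart `c`) (`Fex E π c` does not involve `p`); Zhou's `F̃(e_v)` is
  `modifiedObs E p π (edge p l)`, and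
  `modifiedObsCW E fam p k` / `FiCW` re-index a vertex-wise family of pairings `fam` by the clockwise
  corner index of `medialCornersAt` (the shape `Site 2 × Fin 2 → Fin 4 → ℂ` of per-vertex splits);
* PROVED: `bondDartObservable = modifiedObs + Fi` ((82) rearranged), `norm_obsOn_le_one`,
  pairwise disjointness of the possibilities, `flipAt` is an involution,
  `IsRotationPairing.flipAt_mem_exc`, the restricted bijection
  `IsRotationPairing.bijOn_windingClass` (the winding-class form `ξ_{J,2,·} ↔ ξ_{J+1,1,·}` of the
  cardinality bookkeeping behind (83)–(86)), and NON-VACUITY: the coarse pairing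
  `RotationPairing.coarse` (everything exceptional) satisfies `IsRotationPairing`, under which
  `F_one = F_two = F_θ = 0` and `F̃ = ½ F_ex` — the printed properties alone constrain nothing;
  all the content is in the smallness of `E_v`, which is why that bound is the crux.

## Design: the pairing is a PARAMETER

Zhou himself treats `F̃` as a function of the mapping: p. 52 defines `F̃(·; f̄_v)` (the §3.3
pairing) next to `F̃(·)` (the §3.1 pairing), the Remark on p. 51 names three more pairings
`f_{2,v}, f_{3,v}, f_{4,v}`, and his Prop. 4.1 asserts that all of them give the same `F̃` up to
`O((δ/d_v)^{2−ε})`. The explicit surgeries (36)–(44) (the loop `L_v` attached to `E_v`, its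
mirror images `L^{AC}_v`, `L^{BD}_v`, the random times `t_v, s_v, τ_v, ς_v, τ_∂, τ_d, t_d`, the
edge sets `E_coi ⊇ E_exc`, Case I/II according to `d/r`, "after ignoring an event with
probability of the order `(δ/d)²`") are NOT transcribed: they are given in prose with conventions
the library does not have (indexing of loops, "touches or crosses", reflections of lattice
paths), their one-to-one property is precisely the disputed content of Props. 3.2/3.6, and what
§4 consumes of them is recorded in `IsRotationPairing`. A consumer quantifies over families
`fam : Site 2 × Fin 2 → RotationPairing` with `IsRotationPairing E p (fam p)` and a bound on
`P((fam p).exc)`; further printed properties of Zhou's particular `f_v` (translation covariance,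
Prop. 4.4; boundary behaviour, §5.2 / Prop. 5.7) are additional hypotheses on `fam`, cited where
used.

## Conventions and junk values

* **Winding origin.** Zhou weights a traversal by `exp(+(i/3) W_γ(e, e_b))` (winding from `e` to
  the end); `dartPhaseSum`, hence `obsOn`, and `dartWinding` measure from the start
  (`exp(−(i/3) W_γ(e_a, e))`), as everywhere in this library (`DartPhase.lean`, module docstring):
  for an exploration path the total winding is fixed by the datum, so the two conventions differ
  by one unimodular constant per datum, to which (77)–(82), "winding preserved" and every linear
  relation are insensitive.
* **`A` versus `C`.** The printed labelling is fixed only up to the half-turn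
  `(A,B,C,D) ↦ (C,D,A,B)`; `labelIndex` chooses `A = NE` at horizontal and `A = NW` at vertical
  medial vertices. The half-turn permutes the possibilities (`j ↦ j + 2`) and changes nothing in §4.
* **Measure.** As in `DartPhase.lean`, expectations are Bochner integrals against Bernoulli-`½`
  bond percolation on all of `ℤ²` (`medialExploration E` reads `E.bcBondConfig ω` only); Zhou's
  `P` is uniform on `{0,1}^{E_Ω ∖ ∂_{ba}}`, the same expectations. `obsOn E S c` is the junk value
  of the Bochner integral (`0`) when the integrand is not a.e.-strongly measurable; `flipAt p`
  flips the raw configuration at `E_v = medialVertexOf p`, which commutes with `bcBondConfig` at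
  the interior medial vertices (`halfCREquations E`) where §3–§4 are applied.
* `Traverses`, `dartWinding`, `passTwo` make sense for any list of medial vertices; along
  `medialExploration E ω` (no dart repeated) `dartWinding` has at most one term. `J + 1`, `J + 3`
  are computed in `Fin 4` ("`E^v_{5,1}` is understood as `E^v_{1,1}`").

## What is NOT here

The surgeries (36)–(44) and §3.3's `f̄_v`, `f_{j,v}`, `f_j^v` (see "Design"); the estimates
`P(E_v) ⪯ (δ/d_v)²` / `(δ/d_v)^{2−ε}` (Props. 3.2, 3.6), Lemma 3.1, Prop. 4.1, Lemma 4.2,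
Prop. 4.3 ((93)–(100)), Prop. 4.4 — claims of an unrefereed preprint, to be filed as route items;
the identity (80) (it needs "a dart at `v` is traversed iff `v` is passed once or twice", part of
the well-definedness bookkeeping of `MedialInterface`, whose facts are unproved); the vertex
observables (87)–(89) (they involve a cube root `e_b^{−1/3}`); Condition C and §§5–6.
-/

noncomputable section

open MeasureTheory
open scoped symmDiff
open Literature.Barriers.CriticalPhenomena (medialCornersAt medialVertexOf
  medialCornersAt_injective)

namespace Literature.Probability.LatticeModels.Zhou

/-! ### Zhou's labels `A, B, C, D` at a medial vertex -/

/-- The clockwise corner index (`medialCornersAt`: `0,1,2,3 = NW, NE, SE, SW`) of Zhou's label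
`l = 0,1,2,3 = A,B,C,D` at a medial vertex of direction `i` (`i = 0`: midpoint of a horizontal
lattice edge, `i = 1`: of a vertical one): counterclockwise, with `A` and `C` pointing towards the
vertex — `A, B, C, D = NE, NW, SW, SE` at a horizontal, `= NW, SW, SE, NE` at a vertical medial
vertex (certified by `cornerTarget_edge_zero`, `cornerSource_edge_one`, `cornerTarget_edge_two`,
`cornerSource_edge_three`, `labelIndex_succ`). [cite: Zhou2024SLE6BondZ2, §3.1 p. 22] -/
def labelIndex : Fin 2 → Fin 4 → Fin 4
  | 0 => ![1, 0, 3, 2]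
  | 1 => ![0, 3, 2, 1]

/-- Zhou's medial edge with label `l` (`0,1,2,3 = A,B,C,D`) at the medial vertex `p = (x, i)`,
as a corner `(v, f)` of the library's medial lattice. [cite: Zhou2024SLE6BondZ2, §3.1 p. 22] -/
def edge (p : Site 2 × Fin 2) (l : Fin 4) : Site 2 × Site 2 :=
  medialCornersAt p.1 p.2 (labelIndex p.2 l)

/-- The labelling is a bijection onto the four corners. [cite: Zhou2024SLE6BondZ2, §3.1 p. 22] -/
theorem labelIndex_injective (i : Fin 2) : Function.Injective (labelIndex i) := by
  fin_cases i <;> decide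

/-- **Counterclockwise.** The next label sits one step COUNTERclockwise (clockwise index `− 1`,
i.e. `+ 3` in `Fin 4`). [cite: Zhou2024SLE6BondZ2, §3.1 p. 22] -/
theorem labelIndex_succ (i : Fin 2) (l : Fin 4) : labelIndex i (l + 1) = labelIndex i l + 3 := by
  fin_cases i <;> fin_cases l <;> rfl

/-- The four labelled medial edges at a vertex are distinct. [cite: Zhou2024SLE6BondZ2, §3.1 p. 22] -/
theorem edge_injective (p : Site 2 × Fin 2) : Function.Injective (edge p) :=
  (medialCornersAt_injective p.1 p.2).comp (labelIndex_injective p.2)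

/-- **`A` points towards `v`.** [cite: Zhou2024SLE6BondZ2, §3.1 p. 22] -/
theorem cornerTarget_edge_zero (p : Site 2 × Fin 2) :
    cornerTarget (edge p 0).1 (edge p 0).2 = medialVertexOf p := by
  obtain ⟨x, i⟩ := p
  match i with
  | 0 => simp [edge, labelIndex, medialCornersAt, medialVertexOf, cornerTarget, cornerEdge,
      cornerNeighbor, funext_iff, Fin.forall_fin_two, Function.update_apply]; omega
  | 1 => simp [edge, labelIndex, medialCornersAt, medialVertexOf, cornerTarget, cornerEdge,
      cornerNeighbor, funext_iff, Fin.forall_fin_two, Function.update_apply]; omega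

/-- **`B` points away from `v`.** [cite: Zhou2024SLE6BondZ2, §3.1 p. 22] -/
theorem cornerSource_edge_one (p : Site 2 × Fin 2) :
    cornerSource (edge p 1).1 (edge p 1).2 = medialVertexOf p := by
  obtain ⟨x, i⟩ := p
  match i with
  | 0 => simp [edge, labelIndex, medialCornersAt, medialVertexOf, cornerSource, cornerEdge,
      cornerNeighbor, funext_iff, Fin.forall_fin_two, Function.update_apply]; omega
  | 1 => simp [edge, labelIndex, medialCornersAt, medialVertexOf, cornerSource, cornerEdge,
      cornerNeighbor, funext_iff, Fin.forall_fin_two, Function.update_apply]; omega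

/-- **`C` points towards `v`.** [cite: Zhou2024SLE6BondZ2, §3.1 p. 22] -/
theorem cornerTarget_edge_two (p : Site 2 × Fin 2) :
    cornerTarget (edge p 2).1 (edge p 2).2 = medialVertexOf p := by
  obtain ⟨x, i⟩ := p
  match i with
  | 0 => simp [edge, labelIndex, medialCornersAt, medialVertexOf, cornerTarget, cornerEdge,
      cornerNeighbor, funext_iff, Fin.forall_fin_two, Function.update_apply]; omega
  | 1 => simp [edge, labelIndex, medialCornersAt, medialVertexOf, cornerTarget, cornerEdge,
      cornerNeighbor, funext_iff, Fin.forall_fin_two, Function.update_apply]; omega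

/-- **`D` points away from `v`.** [cite: Zhou2024SLE6BondZ2, §3.1 p. 22] -/
theorem cornerSource_edge_three (p : Site 2 × Fin 2) :
    cornerSource (edge p 3).1 (edge p 3).2 = medialVertexOf p := by
  obtain ⟨x, i⟩ := p
  match i with
  | 0 => simp [edge, labelIndex, medialCornersAt, medialVertexOf, cornerSource, cornerEdge,
      cornerNeighbor, funext_iff, Fin.forall_fin_two, Function.update_apply]; omega
  | 1 => simp [edge, labelIndex, medialCornersAt, medialVertexOf, cornerSource, cornerEdge,
      cornerNeighbor, funext_iff, Fin.forall_fin_two, Function.update_apply]; omega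

/-! ### Traversed darts, their winding, the four possibilities, the flip at `v` -/

/-- The list of medial vertices `γ` *traverses* the dart (corner) `c = (v, f)`: some two
consecutive entries are `cornerSource v f`, `cornerTarget v f` — Zhou's "`e ∈ γ_δ`" for a medial
edge `e`, the indicator inside `dartPhaseSum`. [cite: Zhou2024SLE6BondZ2, §1.2 eq. (1)] -/
def Traverses (γ : List MedialVertex) (c : Site 2 × Site 2) : Prop :=
  ∃ n : ℕ, γ[n]? = some (cornerSource c.1 c.2) ∧ γ[n + 1]? = some (cornerTarget c.1 c.2)

/-- The winding `W_γ(e_a, c)` of the polyline of `γ` (mesh `δ`) from its start up to and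
including the dart `c`: the sum over the traversal positions `n` of `c` of
`Polyline.winding ((γ.map (medialPoint δ)).take (n + 2))` — the real number whose phase
`exp(−iσ ·)` `dartPhaseSum γ δ σ c` sums; one term along an exploration path, `0` if `c` is not
traversed. [cite: Zhou2024SLE6BondZ2, §1.2 ("the winding `W_γ(e₁, e₂)`")] -/
def dartWinding (γ : List MedialVertex) (δ : ℝ) (c : Site 2 × Site 2) : ℝ :=
  ∑ n ∈ (Finset.range γ.length).filter
      (fun n => γ[n]? = some (cornerSource c.1 c.2) ∧ γ[n + 1]? = some (cornerTarget c.1 c.2)),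
    Polyline.winding ((γ.map (medialPoint δ)).take (n + 2))

/-- The empty (junk) path traverses nothing. [cite: Zhou2024SLE6BondZ2, §1.2] -/
theorem not_traverses_nil (c : Site 2 × Site 2) : ¬ Traverses [] c := by
  rintro ⟨n, h, -⟩
  simp at h

/-- Non-vacuity: the path consisting of the single dart `(v, f)` traverses it.
[cite: Zhou2024SLE6BondZ2, §1.2] -/
theorem traverses_pair (v f : Site 2) : Traverses [cornerSource v f, cornerTarget v f] (v, f) :=
  ⟨0, by simp, by simp⟩

/-- A dart that is not traversed contributes no phase (`1_{e ∈ γ} = 0`).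
[cite: Zhou2024SLE6BondZ2, §1.2 eq. (1)] -/
theorem dartPhaseSum_eq_zero_of_not_traverses {γ : List MedialVertex} {c : Site 2 × Site 2}
    (h : ¬ Traverses γ c) (δ σ : ℝ) : dartPhaseSum γ δ σ c = 0 :=
  Finset.sum_eq_zero fun n hn => absurd ⟨n, (Finset.mem_filter.1 hn).2⟩ h

/-- … and has winding `0` (junk). [cite: Zhou2024SLE6BondZ2, §1.2] -/
theorem dartWinding_eq_zero_of_not_traverses {γ : List MedialVertex} {c : Site 2 × Site 2}
    (h : ¬ Traverses γ c) (δ : ℝ) : dartWinding γ δ c = 0 :=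
  Finset.sum_eq_zero fun n hn => absurd ⟨n, (Finset.mem_filter.1 hn).2⟩ h

variable (E : DiscreteDobrushin) (p : Site 2 × Fin 2)

/-- **Possibility `j = J + 1`** of the exploration path of `E` at the medial vertex `p` (p. 22,
pp. 34–35): of the four darts at `p` exactly those labelled `J` and `J − 1` (`= J + 3`) are
traversed — `J = 0`: `A, D ∈ γ, B, C ∉ γ`; `J = 1`: `A, B ∈ γ`; `J = 2`: `B, C ∈ γ`;
`J = 3`: `C, D ∈ γ` ("`γ_δ` passes through `v` and only two medial edges incident to `v` are in
`γ_δ`"). [cite: Zhou2024SLE6BondZ2, §3.1 pp. 22, 34–35] -/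
def passTwo (J : Fin 4) : Set (Percolation.BondConfig (Site 2)) :=
  {ω | ∀ l : Fin 4, Traverses (medialExploration E ω) (edge p l) ↔ (l = J ∨ l = J + 3)}

/-- `v` is passed exactly once (one of the four possibilities). [cite: Zhou2024SLE6BondZ2, §3.1 p. 22] -/
def passTwoAny : Set (Percolation.BondConfig (Site 2)) := ⋃ J, passTwo E p J

/-- "All four medial edges incident to `v` are in `γ_δ`" (`v` is passed twice).
[cite: Zhou2024SLE6BondZ2, §3.1 p. 35] -/
def passFour : Set (Percolation.BondConfig (Site 2)) :=
  {ω | ∀ l : Fin 4, Traverses (medialExploration E ω) (edge p l)}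

/-- `Fin 4` bookkeeping: two distinct possibilities traverse different dart sets. [folklore] -/
private theorem fin4_aux :
    ∀ J J' : Fin 4, J ≠ J' → (J = J' ∨ J = J' + 3) → ¬ (J' = J ∨ J' = J + 3) := by decide

/-- `Fin 4` bookkeeping: possibility `J + 1` never traverses the dart `J + 1`. [folklore] -/
private theorem fin4_aux' : ∀ J : Fin 4, ¬ (J + 1 = J ∨ J + 1 = J + 3) := by decide

/-- The four possibilities are pairwise disjoint. [cite: Zhou2024SLE6BondZ2, §3.1 p. 22] -/
theorem disjoint_passTwo {J J' : Fin 4} (h : J ≠ J') : Disjoint (passTwo E p J) (passTwo E p J') :=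
  Set.disjoint_left.2 fun _ h₁ h₂ =>
    fin4_aux J J' h ((h₂ J).1 ((h₁ J).2 (Or.inl rfl))) ((h₁ J').1 ((h₂ J').2 (Or.inl rfl)))

/-- Passing once and passing twice are disjoint events. [cite: Zhou2024SLE6BondZ2, §3.1 p. 35] -/
theorem disjoint_passTwo_passFour (J : Fin 4) : Disjoint (passTwo E p J) (passFour E p) :=
  Set.disjoint_left.2 fun _ h₁ h₂ => fin4_aux' J ((h₁ (J + 1)).1 (h₂ (J + 1)))

/-- **Zhou's `ω∖E_v`**: the configuration `ω` with the status of the lattice edge `E_v` through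
the medial vertex `p` switched (symmetric difference with `{E_v}`).
[cite: Zhou2024SLE6BondZ2, §3.1 p. 35 (`E^{v,a}_{j,m} = {ω∖E_v : ω ∈ E^v_{j,m}}`)] -/
def flipAt (p : Site 2 × Fin 2) (ω : Percolation.BondConfig (Site 2)) :
    Percolation.BondConfig (Site 2) :=
  ω ∆ {medialVertexOf p}

/-- Membership in the flipped configuration. [cite: Zhou2024SLE6BondZ2, §3.1 p. 35] -/
theorem mem_flipAt_iff {p : Site 2 × Fin 2} {ω : Percolation.BondConfig (Site 2)}
    {e : Sym2 (Site 2)} :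
    e ∈ flipAt p ω ↔ (e ∈ ω ∧ e ≠ medialVertexOf p) ∨ (e = medialVertexOf p ∧ e ∉ ω) := by
  simp only [flipAt, Set.mem_symmDiff, Set.mem_singleton_iff]

/-- Flipping twice restores the configuration. [cite: Zhou2024SLE6BondZ2, §3.1 p. 35] -/
@[simp] theorem flipAt_flipAt (ω : Percolation.BondConfig (Site 2)) : flipAt p (flipAt p ω) = ω :=
  symmDiff_symmDiff_cancel_right _ _

/-- `flipAt p` is an involution (hence a bijection of configurations).
[cite: Zhou2024SLE6BondZ2, §3.1 p. 35] -/
theorem flipAt_involutive : Function.Involutive (flipAt p) := flipAt_flipAt p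

/-! ### Rotation pairings: the data and the printed properties of Prop. 3.2 / 3.6 -/

/-- **The data of Zhou's Proposition 3.2 / 3.6 at one medial vertex**: an exceptional event
`exc = E_v`, the union `second = ⋃_j E^v_{j,2}` of the "second parts" of the four possibilities
(the domain of `f_v`; only its trace on each possibility matters, `cls₂`), and the map
`rot = f_v`. No property is built in (`IsRotationPairing`). Zhou's own instance is produced by
the reflection–flip surgeries (36)–(44) of §3.1 (resp. §3.3 for `f̄_v`), not transcribed here
(module docstring, "Design"). [cite: Zhou2024SLE6BondZ2, Proposition 3.2 (p. 38)] -/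
structure RotationPairing where
  /-- The exceptional event `E_v` ("ignored", of probability `⪯ (δ/d_v)²` in the paper). -/
  exc : Set (Percolation.BondConfig (Site 2))
  /-- `⋃_j E^v_{j,2}`: the configurations in the second class of their possibility. -/
  second : Set (Percolation.BondConfig (Site 2))
  /-- The local rotation `f_v`. -/
  rot : Percolation.BondConfig (Site 2) → Percolation.BondConfig (Site 2)

namespace RotationPairing

variable (π : RotationPairing)

/-- The class `E^v_{J+1,2}` (second part of possibility `J + 1`).
[cite: Zhou2024SLE6BondZ2, §3.1 pp. 34–35, 38] -/
def cls₂ (J : Fin 4) : Set (Percolation.BondConfig (Site 2)) := passTwo E p J ∩ π.second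

/-- The class `E^v_{J+1,1}` (first part of possibility `J + 1`): the rest of the possibility.
[cite: Zhou2024SLE6BondZ2, §3.1 pp. 34–35, 38] -/
def cls₁ (J : Fin 4) : Set (Percolation.BondConfig (Site 2)) := passTwo E p J \ π.second

/-- `E^v_{j,1} ∪ E^v_{j,2}` is possibility `j`. [cite: Zhou2024SLE6BondZ2, §3.1 p. 34] -/
theorem cls₁_union_cls₂ (J : Fin 4) : π.cls₁ E p J ∪ π.cls₂ E p J = passTwo E p J :=
  Set.sdiff_union_inter _ _

/-- … and the two classes are disjoint. [cite: Zhou2024SLE6BondZ2, §3.1 p. 34] -/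
theorem disjoint_cls₁_cls₂ (J : Fin 4) : Disjoint (π.cls₁ E p J) (π.cls₂ E p J) :=
  Set.disjoint_left.2 fun _ h₁ h₂ => h₁.2 h₂.2

/-- The COARSE pairing: every once-passing configuration and its flip is exceptional, no second
classes, `f_v = id`. It satisfies all printed properties vacuously (`isRotationPairing_coarse`):
the content of Prop. 3.2/3.6 lies in the smallness of `E_v`. [folklore] -/
def coarse : RotationPairing where
  exc := passTwoAny E p ∪ flipAt p '' passTwoAny E p
  second := ∅
  rot := id

end RotationPairing

/-- **The printed properties of Zhou's Prop. 3.2 (p. 38) / Prop. 3.6 (p. 50), probability bound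
excluded**, for a pairing `π` at the medial vertex `p` of the datum `E`: the exceptional event is
`E_v = E_{v,0} ∪ {ω∖E_v : ω ∈ E_{v,0}}` with `E_{v,0}` consisting of once-passing configurations;
for each `j`, `f_v` is "a one-to-one and onto mapping" `E^v_{j,2} ∖ E_v → E^v_{j+1,1} ∖ E_v`
(`E^v_{5,1} = E^v_{1,1}`); and the medial edge common to possibilities `j`, `j + 1` (label `J`)
keeps its winding, `W_{f_v(γ)}(e_J) = W_γ(e_J)`. The bound "`P(E_v)` at most of the order
`(δ/d)²`" (resp. `(δ/d_v)^{2−ε}`) is the paper's CLAIM and is deliberately not a field.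
[cite: Zhou2024SLE6BondZ2, Proposition 3.2 (p. 38) and Proposition 3.6 (p. 50)] -/
structure IsRotationPairing (π : RotationPairing) : Prop where
  /-- `E_v = E_{v,0} ∪ E_{v,1}`, `E_{v,1} = flipAt(E_{v,0})`, `E_{v,0} ⊆` once-passing. -/
  exc_eq : ∃ E₀ ⊆ passTwoAny E p, π.exc = E₀ ∪ flipAt p '' E₀
  /-- `f_v : E^v_{j,2} ∖ E_v → E^v_{j+1,1} ∖ E_v` is one-to-one and onto. -/
  bijOn : ∀ J : Fin 4, Set.BijOn π.rot (π.cls₂ E p J \ π.exc) (π.cls₁ E p (J + 1) \ π.exc)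
  /-- The common dart `J` keeps its winding under `f_v`. -/
  dartWinding_rot : ∀ J : Fin 4, ∀ ω ∈ π.cls₂ E p J \ π.exc,
    dartWinding (medialExploration E (π.rot ω)) E.δ (edge p J) =
      dartWinding (medialExploration E ω) E.δ (edge p J)

variable {E p}

/-- The exceptional event is stable under the flip at `v` (`E_v = E_{v,0} ∪ flipAt(E_{v,0})` and
`flipAt` is an involution). [cite: Zhou2024SLE6BondZ2, Proposition 3.2 (p. 38)] -/
theorem IsRotationPairing.flipAt_mem_exc {π : RotationPairing} (h : IsRotationPairing E p π)
    (ω : Percolation.BondConfig (Site 2)) : flipAt p ω ∈ π.exc ↔ ω ∈ π.exc := by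
  obtain ⟨E₀, -, hE⟩ := h.exc_eq
  rw [hE]
  constructor
  · rintro (h₁ | ⟨ω', h₁, h₂⟩)
    · exact Or.inr ⟨_, h₁, flipAt_flipAt p ω⟩
    · exact Or.inl ((flipAt_involutive p).injective h₂ ▸ h₁)
  · rintro (h₁ | ⟨ω', h₁, rfl⟩)
    · exact Or.inr ⟨ω, h₁, rfl⟩
    · exact Or.inl ((flipAt_flipAt p ω').symm ▸ h₁)

/-- **Winding classes correspond.** Under the printed properties `f_v` restricts, for every value
`w` of the winding of the common dart `J`, to a bijection
`{ω ∈ E^v_{j,2} ∖ E_v : W = w} → {ω ∈ E^v_{j+1,1} ∖ E_v : W = w}` — the bijection form of the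
cardinality identities (`ξ^v_{1,2,k} = ξ^v_{2,1,k}`, …) feeding (83)–(86).
[cite: Zhou2024SLE6BondZ2, Proposition 3.6 and p. 53] -/
theorem IsRotationPairing.bijOn_windingClass {π : RotationPairing} (h : IsRotationPairing E p π)
    (J : Fin 4) (w : ℝ) :
    Set.BijOn π.rot
      ((π.cls₂ E p J \ π.exc) ∩ {ω | dartWinding (medialExploration E ω) E.δ (edge p J) = w})
      ((π.cls₁ E p (J + 1) \ π.exc) ∩
        {ω | dartWinding (medialExploration E ω) E.δ (edge p J) = w}) := by
  obtain ⟨hm, hi, hs⟩ := h.bijOn J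
  refine ⟨fun ω hω => ⟨hm hω.1, ?_⟩, hi.mono Set.inter_subset_left, fun ω' hω' => ?_⟩
  · rw [Set.mem_setOf_eq, h.dartWinding_rot J ω hω.1]
    exact hω.2
  · obtain ⟨ω, hω, rfl⟩ := hs hω'.1
    refine ⟨ω, ⟨hω, ?_⟩, rfl⟩
    rw [Set.mem_setOf_eq, ← h.dartWinding_rot J ω hω]
    exact hω'.2

variable (E p)

/-- **Non-vacuity / weakness without the probability bound**: the coarse pairing has all the
printed properties. [folklore] -/
theorem isRotationPairing_coarse : IsRotationPairing E p (RotationPairing.coarse E p) := by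
  have h₂ : ∀ J, (RotationPairing.coarse E p).cls₂ E p J = ∅ := fun J => Set.inter_empty _
  have h₁ : ∀ J, (RotationPairing.coarse E p).cls₁ E p J \ (RotationPairing.coarse E p).exc = ∅ :=
    fun J => Set.sdiff_eq_empty.2 fun ω hω => Or.inl (Set.mem_iUnion.2 ⟨J, hω.1⟩)
  refine ⟨⟨passTwoAny E p, subset_rfl, rfl⟩, fun J => ?_, fun J ω hω => ?_⟩
  · rw [h₂, Set.empty_sdiff, h₁]
    exact Set.bijOn_empty _
  · rw [h₂, Set.empty_sdiff] at hω
    exact hω.elim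

/-! ### The observables (77)–(82) -/

/-- The restricted `q = 1` edge observable `E_{1/2}[φ_c(ω); ω ∈ S]` of the datum `E` at the dart
`c`, `φ_c(ω) = dartPhaseSum (medialExploration E ω) E.δ (1/3) c` (phase `exp(−(i/3) W)` of the
traversal of `c`, `0` if `c ∉ γ`): the building block of (77)–(80). `S = univ` gives the raw
observable `bondDartObservable E E.δ (1/3) c` (`obsOn_univ`). [cite: Zhou2024SLE6BondZ2, §4 eqs. (77)–(80)] -/
def obsOn (S : Set (Percolation.BondConfig (Site 2))) (c : Site 2 × Site 2) : ℂ :=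
  ∫ ω, S.indicator (fun ω => dartPhaseSum (medialExploration E ω) E.δ (1 / 3) c) ω
    ∂(Percolation.bondPercolation (zdGraph 2) Percolation.half)

/-- Restricting to the empty event gives `0`. [cite: Zhou2024SLE6BondZ2, §4 eq. (80)] -/
@[simp] theorem obsOn_empty (c : Site 2 × Site 2) : obsOn E ∅ c = 0 := by
  simp [obsOn]

/-- No restriction gives Smirnov's raw edge observable `F`. [cite: Zhou2024SLE6BondZ2, §1.2 eq. (1)] -/
theorem obsOn_univ (c : Site 2 × Site 2) : obsOn E Set.univ c = bondDartObservable E E.δ (1 / 3) c := by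
  simp [obsOn, bondDartObservable_def]

/-- `|E[φ_c; S]| ≤ 1` (at most one unimodular phase under a probability measure).
[cite: Zhou2024SLE6BondZ2, §1.2 eq. (1)] -/
theorem norm_obsOn_le_one (S : Set (Percolation.BondConfig (Site 2))) (c : Site 2 × Site 2) :
    ‖obsOn E S c‖ ≤ 1 := by
  refine (norm_integral_le_of_norm_le_const (C := 1) (Filter.Eventually.of_forall fun ω => ?_)).trans
    (by simp)
  exact (norm_indicator_le_norm_self _ _).trans
    (norm_dartPhaseSum_le_one (nodup_zip_tail_medialExploration E ω) _ _ _)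

variable (π : RotationPairing)

/-- **`F_one` (78)**: `E[φ_e; ω ∈ ⋃_j (E^v_{j,1} ∪ E^v_{j,2}) ∖ E_v]` — `v` passed once, off the
exceptional event. [cite: Zhou2024SLE6BondZ2, §4 eq. (78)] -/
def Fone (c : Site 2 × Site 2) : ℂ := obsOn E (passTwoAny E p \ π.exc) c

/-- **`F_two` (79)**: `E[φ_e; ω ∈ ⋃_j (E^{v,a}_{j,1} ∪ E^{v,a}_{j,2}) ∖ E_v]` — the flips of the
once-passing configurations ("all four medial edges … are in `γ_δ`"), off `E_v`.
[cite: Zhou2024SLE6BondZ2, §4 eq. (79)] -/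
def Ftwo (c : Site 2 × Site 2) : ℂ := obsOn E (flipAt p '' passTwoAny E p \ π.exc) c

/-- **`F_θ` (77)**: `e^{−iθ} E[φ_e; ω ∈ ⋃_j E^{v,a}_{j,2} ∖ E_v] + e^{iθ} E[φ_e; ω ∈ ⋃_j E^{v,a}_{j,1} ∖ E_v]`
— the flipped configurations weighted according to the class of their once-passing partner; used
at `θ = π/12`. [cite: Zhou2024SLE6BondZ2, §4 eq. (77)] -/
def Ftheta (θ : ℝ) (c : Site 2 × Site 2) : ℂ :=
  Complex.exp (-(θ * Complex.I)) * obsOn E (flipAt p '' (⋃ J, π.cls₂ E p J) \ π.exc) c +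
    Complex.exp (θ * Complex.I) * obsOn E (flipAt p '' (⋃ J, π.cls₁ E p J) \ π.exc) c

/-- **`F_ex` (80)**: `E[φ_e; ω ∈ E_v]`, the exceptional part. [cite: Zhou2024SLE6BondZ2, §4 eq. (80)] -/
def Fex (c : Site 2 × Site 2) : ℂ := obsOn E π.exc c

/-- The leading constant `(3√3 + 5)/(6√3 + 6)` of (81). [cite: Zhou2024SLE6BondZ2, §4 eq. (81)] -/
def coefMain : ℝ := (3 * Real.sqrt 3 + 5) / (6 * Real.sqrt 3 + 6)

/-- The constant `(√3 − 1)/√2` in front of `F_{π/12}` in (81) (`= 2 sin (π/12)`).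
[cite: Zhou2024SLE6BondZ2, §4 eq. (81)] -/
def coefTheta : ℝ := (Real.sqrt 3 - 1) / Real.sqrt 2

/-- `(3√3 + 5)/(6√3 + 6) = (2 + √3)/6`. [cite: Zhou2024SLE6BondZ2, §4 eq. (81)] -/
theorem coefMain_eq : coefMain = (2 + Real.sqrt 3) / 6 := by
  have h3 : Real.sqrt 3 * Real.sqrt 3 = 3 := Real.mul_self_sqrt (by norm_num)
  have hpos : 0 < 6 * Real.sqrt 3 + 6 := by positivity
  rw [coefMain, div_eq_div_iff hpos.ne' (by norm_num)]
  nlinarith [h3]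

/-- **Zhou's modified parafermionic edge observable `F̃` (81)** of the datum `E` at the medial
vertex `p`, for the pairing `π`, evaluated at the dart `c` (Zhou: `c = e_v ∈ {A, B, C, D}`, i.e.
`c = edge p l`):
`F̃(e_v) = (3√3+5)/(6√3+6) · (√3 F_one(e_v) + F_two(e_v) + ((√3−1)/√2) F_{π/12}(e_v)) + ½ F_ex(e_v)`.
[cite: Zhou2024SLE6BondZ2, §4 Definition p. 52, eq. (81)] -/
def modifiedObs (c : Site 2 × Site 2) : ℂ :=
  (coefMain : ℂ) * ((Real.sqrt 3 : ℂ) * Fone E p π c + Ftwo E p π c +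
      (coefTheta : ℂ) * Ftheta E p π (Real.pi / 12) c) +
    (1 / 2 : ℂ) * Fex E π c

/-- **`F_i` (82)**: `F_i(e_v) = F(e_v) − F̃(e_v)`, `F` the raw observable
`bondDartObservable E E.δ (1/3)`. [cite: Zhou2024SLE6BondZ2, §4 Definition p. 52, eq. (82)] -/
def Fi (c : Site 2 × Site 2) : ℂ := bondDartObservable E E.δ (1 / 3) c - modifiedObs E p π c

/-- The split `F = F̃ + F_i` ((82) rearranged). [cite: Zhou2024SLE6BondZ2, §4 eq. (82)] -/
theorem bondDartObservable_eq_modifiedObs_add_Fi (c : Site 2 × Site 2) :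
    bondDartObservable E E.δ (1 / 3) c = modifiedObs E p π c + Fi E p π c :=
  (add_sub_cancel _ _).symm

/-- `F̃` of a vertex-wise family of pairings `fam`, indexed like the route-side per-vertex splits:
medial vertex `p = (x, i)` and CLOCKWISE corner index `k` of `medialCornersAt x i k`
(`NW, NE, SE, SW`). [cite: Zhou2024SLE6BondZ2, §4 eq. (81)] -/
def modifiedObsCW (fam : Site 2 × Fin 2 → RotationPairing) (p : Site 2 × Fin 2) (k : Fin 4) : ℂ :=
  modifiedObs E p (fam p) (medialCornersAt p.1 p.2 k)

/-- `F_i` of a vertex-wise family of pairings, clockwise corner index. [cite: Zhou2024SLE6BondZ2, §4 eq. (82)] -/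
def FiCW (fam : Site 2 × Fin 2 → RotationPairing) (p : Site 2 × Fin 2) (k : Fin 4) : ℂ :=
  Fi E p (fam p) (medialCornersAt p.1 p.2 k)

/-- Zhou's `F̃(e_v)` at the label `l` is the clockwise-indexed value at `labelIndex i l`.
[cite: Zhou2024SLE6BondZ2, §4 eq. (81)] -/
theorem modifiedObs_edge (fam : Site 2 × Fin 2 → RotationPairing) (l : Fin 4) :
    modifiedObs E p (fam p) (edge p l) = modifiedObsCW E fam p (labelIndex p.2 l) := rfl

/-- Under the coarse pairing `F_one = 0`, … [folklore] -/
theorem Fone_coarse (c : Site 2 × Site 2) : Fone E p (RotationPairing.coarse E p) c = 0 := by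
  rw [Fone, show (RotationPairing.coarse E p).exc = passTwoAny E p ∪ flipAt p '' passTwoAny E p
    from rfl, Set.sdiff_eq_empty.2 Set.subset_union_left, obsOn_empty]

/-- … `F_two = 0`, … [folklore] -/
theorem Ftwo_coarse (c : Site 2 × Site 2) : Ftwo E p (RotationPairing.coarse E p) c = 0 := by
  rw [Ftwo, show (RotationPairing.coarse E p).exc = passTwoAny E p ∪ flipAt p '' passTwoAny E p
    from rfl, Set.sdiff_eq_empty.2 Set.subset_union_right, obsOn_empty]

/-- … `F_θ = 0`, … [folklore] -/
theorem Ftheta_coarse (θ : ℝ) (c : Site 2 × Site 2) :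
    Ftheta E p (RotationPairing.coarse E p) θ c = 0 := by
  have h₂ : (⋃ J, (RotationPairing.coarse E p).cls₂ E p J) = ∅ :=
    Set.iUnion_eq_empty.2 fun J => Set.inter_empty _
  have h₁ : flipAt p '' (⋃ J, (RotationPairing.coarse E p).cls₁ E p J) \
      (RotationPairing.coarse E p).exc = ∅ := by
    refine Set.sdiff_eq_empty.2 ((Set.image_mono ?_).trans Set.subset_union_right)
    exact Set.iUnion_mono fun J => Set.sdiff_subset
  rw [Ftheta, h₂, Set.image_empty, Set.empty_sdiff, h₁, obsOn_empty, mul_zero, mul_zero, add_zero]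

/-- … and `F̃ = ½ F_ex`: without a bound on `E_v` the printed properties do not pin `F̃` down.
[folklore] -/
theorem modifiedObs_coarse (c : Site 2 × Site 2) :
    modifiedObs E p (RotationPairing.coarse E p) c =
      (1 / 2 : ℂ) * Fex E (RotationPairing.coarse E p) c := by
  rw [modifiedObs, Fone_coarse, Ftwo_coarse, Ftheta_coarse]
  ring

end Literature.Probability.LatticeModels.Zhou

end
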